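import Mathlib.Data.Nat.Squarefree
import Mathlib.Data.Nat.Choose.Sum
import Mathlib.Analysis.SpecialFunctions.Log.Basic
import Summits.Parity.BatemanHorn.Theorems.SoloInformedLambdaKValues

/-!
# SoloInformedMoebiusLogPow — `∑_{e ∣ m} μ(e) logʲ e` vanishes for `j < ω(m)` and equals `(-1)ᵏ Λ_k(m)` at `j = k ≤ ω(m)`

Solo unit `solo-Parity-informed` (ideation tier, informed mode), session 17; `PLAN.md` §25.2, CLAIMS C76.

For `m ≠ 0` the divisor sum `A_j(m) := ∑_{e ∣ m} μ(e) (log e)ʲ` only sees the squarefree divisors, i.e. the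
subsets `S` of the set `P` of prime factors of `m`, and equals the purely combinatorial quantity
`G_P(j) := ∑_{S ⊆ P} (-1)^{#S} (∑_{p ∈ S} log p)ʲ`.

* `sum_powerset_neg_one_pow_card_mul_sum_pow_eq_zero` / `…_eq_of_card_eq` — for ANY weights `x : α → ℝ`:
  `G_P(j) = 0` for `j < #P` and `G_P(#P) = (-1)^{#P} (#P)! ∏_{p ∈ P} x p`
  (induction on `P` with the binomial theorem: `G_{P ∪ {q}}(j) = -∑_{i<j} C(j,i) x_q^{j-i} G_P(i)`);
* `sum_divisors_moebius_mul_eq_sum_powerset_primeFactors` — `∑_{e ∣ m} μ(e) φ(e) = ∑_{S ⊆ P} (-1)^{#S} φ(∏ S)`;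
* `sum_divisors_moebius_mul_log_pow_eq_zero` — `j < ω(m) ⟹ A_j(m) = 0`;
* `sum_divisors_moebius_mul_log_pow_eq_of_card` — `ω(m) = k ⟹ A_k(m) = (-1)ᵏ k! ∏_{p ∣ m} log p`;
* `generalizedVonMangoldt_eq_neg_one_pow_mul_sum_divisors` — `k ≤ ω(m) ⟹ Λ_k(m) = (-1)ᵏ A_k(m)`
  (with C69 `generalizedVonMangoldt_eq_of_card_primeFactors` and the tree's vanishing of `Λ_k` for `ω > k`);
* `abs_sum_divisors_moebius_mul_log_pow_le` — the crude bound `|A_j(m)| ≤ 2^{ω(m)} (log m)ʲ`.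

These identities drive the `k`-dimensional large-divisor localisation of Bateman–Horn for systems: the lower
log-moments of `μ ρ_F` are never needed, because `A_j(|F(n)|)` vanishes identically for `j < ω(|F(n)|)`.
Elementary (Mathlib + the tree's `Λ_k` algebra).
-/

namespace Summit.Parity.BatemanHorn.Theorems

open Finset ArithmeticFunction
open scoped ArithmeticFunction.Moebius
open Literature.NumberTheory.Sieve (generalizedVonMangoldt generalizedVonMangoldt_eq_zero_of_lt_card_primeFactors)

section Combinatorial

variable {α : Type*} [DecidableEq α] (x : α → ℝ)

/-- The recurrence behind the combinatorial lemma: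
`G_{insert a s}(j) = -∑_{i<j} C(j,i) (x a)^{j-i} G_s(i)` (binomial theorem). -/
theorem sum_powerset_insert_neg_one_pow_card_mul_sum_pow {a : α} {s : Finset α} (ha : a ∉ s) (j : ℕ) :
    ∑ t ∈ (insert a s).powerset, (-1 : ℝ) ^ t.card * (∑ p ∈ t, x p) ^ j =
      -∑ i ∈ range j, (j.choose i : ℝ) * x a ^ (j - i) *
        ∑ t ∈ s.powerset, (-1 : ℝ) ^ t.card * (∑ p ∈ t, x p) ^ i := by
  rw [Finset.sum_powerset_insert ha]
  have h2 : ∀ t ∈ s.powerset, (-1 : ℝ) ^ (insert a t).card * (∑ p ∈ insert a t, x p) ^ j =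
      ∑ i ∈ range (j + 1), -((j.choose i : ℝ) * x a ^ (j - i) *
        ((-1 : ℝ) ^ t.card * (∑ p ∈ t, x p) ^ i)) := by
    intro t ht
    have hat : a ∉ t := fun h => ha (mem_powerset.mp ht h)
    rw [card_insert_of_notMem hat, sum_insert hat, add_comm (x a), add_pow, pow_succ, Finset.mul_sum]
    exact sum_congr rfl fun i _ => by ring
  have h3 : ∑ t ∈ s.powerset, (-1 : ℝ) ^ (insert a t).card * (∑ p ∈ insert a t, x p) ^ j =
      -∑ i ∈ range (j + 1), (j.choose i : ℝ) * x a ^ (j - i) *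
        ∑ t ∈ s.powerset, (-1 : ℝ) ^ t.card * (∑ p ∈ t, x p) ^ i := by
    rw [sum_congr rfl h2, sum_comm, ← sum_neg_distrib]
    refine sum_congr rfl fun i _ => ?_
    rw [Finset.mul_sum, ← sum_neg_distrib]
  rw [h3, sum_range_succ, Nat.choose_self, Nat.sub_self, pow_zero, Nat.cast_one, one_mul, one_mul]
  ring

/-- **Combinatorial lemma.**  For every finite set `s`, weights `x`, and `j`:
`∑_{t ⊆ s} (-1)^{#t} (∑_{p∈t} x p)ʲ` is `0` for `j < #s` and `(-1)^{#s} (#s)! ∏_{p ∈ s} x p` for `j = #s`. -/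
theorem sum_powerset_neg_one_pow_card_mul_sum_pow (s : Finset α) :
    ∀ j : ℕ, (j < s.card → ∑ t ∈ s.powerset, (-1 : ℝ) ^ t.card * (∑ p ∈ t, x p) ^ j = 0) ∧
      (j = s.card → ∑ t ∈ s.powerset, (-1 : ℝ) ^ t.card * (∑ p ∈ t, x p) ^ j =
        (-1 : ℝ) ^ s.card * (s.card.factorial : ℝ) * ∏ p ∈ s, x p) := by
  induction s using Finset.induction_on with
  | empty =>
    intro j
    refine ⟨fun h => absurd h (by simp), fun h => ?_⟩
    rw [Finset.card_empty] at h
    subst h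
    simp
  | insert a s ha ih =>
    intro j
    rw [card_insert_of_notMem ha, sum_powerset_insert_neg_one_pow_card_mul_sum_pow x ha]
    constructor
    · intro hj
      rw [sum_eq_zero, neg_zero]
      intro i hi
      rw [(ih i).1 (by have := mem_range.mp hi; omega), mul_zero]
    · intro hj
      subst hj
      rw [sum_range_succ, sum_eq_zero (fun i hi => ?_), zero_add, (ih s.card).2 rfl,
        prod_insert ha, Nat.factorial_succ, Nat.choose_succ_self_right, Nat.add_sub_cancel_left, pow_one]
      · push_cast
        ring
      · rw [(ih i).1 (mem_range.mp hi), mul_zero]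

/-- `j < #s ⟹ ∑_{t ⊆ s} (-1)^{#t} (∑_{p∈t} x p)ʲ = 0`. -/
theorem sum_powerset_neg_one_pow_card_mul_sum_pow_eq_zero {s : Finset α} {j : ℕ} (hj : j < s.card) :
    ∑ t ∈ s.powerset, (-1 : ℝ) ^ t.card * (∑ p ∈ t, x p) ^ j = 0 :=
  (sum_powerset_neg_one_pow_card_mul_sum_pow x s j).1 hj

/-- `∑_{t ⊆ s} (-1)^{#t} (∑_{p∈t} x p)^{#s} = (-1)^{#s} (#s)! ∏_{p∈s} x p`. -/
theorem sum_powerset_neg_one_pow_card_mul_sum_pow_eq_of_card_eq {s : Finset α} {k : ℕ} (hk : s.card = k) :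
    ∑ t ∈ s.powerset, (-1 : ℝ) ^ t.card * (∑ p ∈ t, x p) ^ k =
      (-1 : ℝ) ^ k * (k.factorial : ℝ) * ∏ p ∈ s, x p := by
  subst hk
  exact (sum_powerset_neg_one_pow_card_mul_sum_pow x s s.card).2 rfl

omit [DecidableEq α] in
/-- Crude bound: for nonnegative weights, `|∑_{t ⊆ s} (-1)^{#t} (∑_{p∈t} x p)ʲ| ≤ 2^{#s} (∑_{p∈s} x p)ʲ`. -/
theorem abs_sum_powerset_neg_one_pow_card_mul_sum_pow_le {s : Finset α} (hx : ∀ p ∈ s, 0 ≤ x p) (j : ℕ) :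
    |∑ t ∈ s.powerset, (-1 : ℝ) ^ t.card * (∑ p ∈ t, x p) ^ j| ≤ 2 ^ s.card * (∑ p ∈ s, x p) ^ j := by
  refine (abs_sum_le_sum_abs _ _).trans ?_
  have hle : ∀ t ∈ s.powerset, |(-1 : ℝ) ^ t.card * (∑ p ∈ t, x p) ^ j| ≤ (∑ p ∈ s, x p) ^ j := by
    intro t ht
    have hts : t ⊆ s := mem_powerset.mp ht
    have ht0 : 0 ≤ ∑ p ∈ t, x p := sum_nonneg fun p hp => hx p (hts hp)
    rw [abs_mul, abs_pow, abs_neg, abs_one, one_pow, one_mul, abs_of_nonneg (pow_nonneg ht0 _)]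
    exact pow_le_pow_left₀ ht0 (sum_le_sum_of_subset_of_nonneg hts fun p hp _ => hx p hp) _
  refine (sum_le_sum hle).trans ?_
  rw [sum_const, card_powerset, nsmul_eq_mul]
  push_cast
  exact le_rfl

end Combinatorial

/-! ### Möbius sums over divisors as sums over subsets of the prime factors -/

/-- `μ(∏_{p ∈ S} p) = (-1)^{#S}` for a finite set `S` of primes. -/
theorem moebius_prod_primes {S : Finset ℕ} (hS : ∀ p ∈ S, p.Prime) :
    μ (∏ p ∈ S, p) = (-1) ^ S.card := by
  induction S using Finset.induction_on with
  | empty => simp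
  | insert q S hq ih =>
    have hS' : ∀ p ∈ S, p.Prime := fun p hp => hS p (mem_insert_of_mem hp)
    have hqp : q.Prime := hS q (mem_insert_self q S)
    have hcop : Nat.Coprime q (∏ p ∈ S, p) :=
      Nat.Coprime.prod_right fun p hp => (Nat.coprime_primes hqp (hS' p hp)).mpr fun h => hq (h ▸ hp)
    rw [prod_insert hq, ArithmeticFunction.isMultiplicative_moebius.map_mul_of_coprime hcop, ih hS',
      ArithmeticFunction.moebius_apply_prime hqp, card_insert_of_notMem hq, pow_succ]
    ring

/-- `log (∏_{p∈S} p) = ∑_{p∈S} log p` for a finite set of primes (cast to `ℝ`). -/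
theorem log_prod_primes {S : Finset ℕ} (hS : ∀ p ∈ S, p.Prime) :
    Real.log ((∏ p ∈ S, p : ℕ) : ℝ) = ∑ p ∈ S, Real.log p := by
  rw [Nat.cast_prod, Real.log_prod]
  intro p hp
  exact_mod_cast (hS p hp).ne_zero

/-- **Squarefree support of `μ`.**  For `m ≠ 0` and any `φ`:
`∑_{e ∣ m} μ(e) φ(e) = ∑_{S ⊆ primeFactors m} (-1)^{#S} φ(∏_{p∈S} p)`. -/
theorem sum_divisors_moebius_mul_eq_sum_powerset_primeFactors {m : ℕ} (hm : m ≠ 0) (φ : ℕ → ℝ) :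
    ∑ e ∈ m.divisors, (μ e : ℝ) * φ e =
      ∑ S ∈ m.primeFactors.powerset, (-1 : ℝ) ^ S.card * φ (∏ p ∈ S, p) := by
  have h1 : ∑ e ∈ m.divisors, (μ e : ℝ) * φ e = ∑ e ∈ m.divisors with Squarefree e, (μ e : ℝ) * φ e := by
    rw [sum_filter]
    refine sum_congr rfl fun e _ => ?_
    split_ifs with h
    · rfl
    · rw [ArithmeticFunction.moebius_eq_zero_of_not_squarefree h, Int.cast_zero, zero_mul]
  have hpf : (UniqueFactorizationMonoid.normalizedFactors m).toFinset = m.primeFactors := by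
    rw [Nat.factors_eq]
    rfl
  rw [h1, Nat.sum_divisors_filter_squarefree hm, hpf]
  refine sum_congr rfl fun S hS => ?_
  have hSp : ∀ p ∈ S, p.Prime := fun p hp => Nat.prime_of_mem_primeFactors (mem_powerset.mp hS hp)
  have hval : S.val.prod = ∏ p ∈ S, p := by rw [Finset.prod_val]; rfl
  rw [hval, moebius_prod_primes hSp]
  push_cast
  ring

/-- `∑_{e ∣ m} μ(e) (log e)ʲ = ∑_{S ⊆ primeFactors m} (-1)^{#S} (∑_{p∈S} log p)ʲ` (`m ≠ 0`). -/
theorem sum_divisors_moebius_mul_log_pow_eq {m : ℕ} (hm : m ≠ 0) (j : ℕ) :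
    ∑ e ∈ m.divisors, (μ e : ℝ) * Real.log e ^ j =
      ∑ S ∈ m.primeFactors.powerset, (-1 : ℝ) ^ S.card * (∑ p ∈ S, Real.log p) ^ j := by
  rw [sum_divisors_moebius_mul_eq_sum_powerset_primeFactors hm (fun e => Real.log e ^ j)]
  refine sum_congr rfl fun S hS => ?_
  have hSp : ∀ p ∈ S, p.Prime := fun p hp => Nat.prime_of_mem_primeFactors (mem_powerset.mp hS hp)
  simp only [log_prod_primes hSp]

/-- **Vanishing below `ω`.**  `m ≠ 0`, `j < ω(m)` ⟹ `∑_{e ∣ m} μ(e) (log e)ʲ = 0`. -/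
theorem sum_divisors_moebius_mul_log_pow_eq_zero {m j : ℕ} (hm : m ≠ 0) (hj : j < m.primeFactors.card) :
    ∑ e ∈ m.divisors, (μ e : ℝ) * Real.log e ^ j = 0 := by
  rw [sum_divisors_moebius_mul_log_pow_eq hm]
  exact sum_powerset_neg_one_pow_card_mul_sum_pow_eq_zero _ hj

/-- **The value at `j = ω(m)`.**  `m ≠ 0`, `ω(m) = k` ⟹ `∑_{e ∣ m} μ(e) (log e)ᵏ = (-1)ᵏ k! ∏_{p ∣ m} log p`. -/
theorem sum_divisors_moebius_mul_log_pow_eq_of_card {m k : ℕ} (hm : m ≠ 0) (hk : m.primeFactors.card = k) :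
    ∑ e ∈ m.divisors, (μ e : ℝ) * Real.log e ^ k =
      (-1 : ℝ) ^ k * (k.factorial : ℝ) * ∏ p ∈ m.primeFactors, Real.log p := by
  rw [sum_divisors_moebius_mul_log_pow_eq hm]
  exact sum_powerset_neg_one_pow_card_mul_sum_pow_eq_of_card_eq _ hk

/-- **`Λ_k(m) = (-1)ᵏ ∑_{e ∣ m} μ(e) (log e)ᵏ` whenever `k ≤ ω(m)`** (`m ≠ 0`).  For `ω(m) = k` both sides are
`k! ∏_{p∣m} log p` (C69); for `ω(m) > k` both vanish. -/
theorem generalizedVonMangoldt_eq_neg_one_pow_mul_sum_divisors {m k : ℕ} (hm : m ≠ 0)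
    (hk : k ≤ m.primeFactors.card) :
    generalizedVonMangoldt k m = (-1 : ℝ) ^ k * ∑ e ∈ m.divisors, (μ e : ℝ) * Real.log e ^ k := by
  rcases hk.lt_or_eq with hlt | heq
  · rw [generalizedVonMangoldt_eq_zero_of_lt_card_primeFactors hlt,
      sum_divisors_moebius_mul_log_pow_eq_zero hm hlt, mul_zero]
  · rw [generalizedVonMangoldt_eq_of_card_primeFactors k m hm heq.symm,
      sum_divisors_moebius_mul_log_pow_eq_of_card hm heq.symm, ← mul_assoc, ← mul_assoc, ← pow_add,
      ← two_mul, pow_mul, neg_one_sq, one_pow, one_mul]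

/-- **Crude bound.**  `m ≠ 0` ⟹ `|∑_{e ∣ m} μ(e) (log e)ʲ| ≤ 2^{ω(m)} (log m)ʲ`. -/
theorem abs_sum_divisors_moebius_mul_log_pow_le {m : ℕ} (hm : m ≠ 0) (j : ℕ) :
    |∑ e ∈ m.divisors, (μ e : ℝ) * Real.log e ^ j| ≤ 2 ^ m.primeFactors.card * Real.log m ^ j := by
  rw [sum_divisors_moebius_mul_log_pow_eq hm]
  have hx : ∀ p ∈ m.primeFactors, 0 ≤ Real.log p := fun p _ => Real.log_natCast_nonneg p
  refine (abs_sum_powerset_neg_one_pow_card_mul_sum_pow_le _ hx j).trans ?_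
  have hsum : ∑ p ∈ m.primeFactors, Real.log p ≤ Real.log m := by
    rw [← log_prod_primes fun p hp => Nat.prime_of_mem_primeFactors hp]
    have hdvd := Nat.prod_primeFactors_dvd m
    have hpos : 0 < ∏ p ∈ m.primeFactors, p := Nat.pos_of_dvd_of_pos hdvd (Nat.pos_of_ne_zero hm)
    exact Real.log_le_log (by exact_mod_cast hpos) (by exact_mod_cast Nat.le_of_dvd (Nat.pos_of_ne_zero hm) hdvd)
  exact mul_le_mul_of_nonneg_left (pow_le_pow_left₀ (sum_nonneg hx) hsum j) (pow_nonneg (by norm_num) _)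

/-- The crude bound with any upper bound `B ≥ ω(m)` in the exponent:
`|∑_{e ∣ m} μ(e) (log e)ʲ| ≤ 2^B (log m)ʲ`. -/
theorem abs_sum_divisors_moebius_mul_log_pow_le' {m : ℕ} (hm : m ≠ 0) (j B : ℕ)
    (hB : m.primeFactors.card ≤ B) :
    |∑ e ∈ m.divisors, (μ e : ℝ) * Real.log e ^ j| ≤ 2 ^ B * Real.log m ^ j :=
  (abs_sum_divisors_moebius_mul_log_pow_le hm j).trans (mul_le_mul_of_nonneg_right
    (pow_le_pow_right₀ (by norm_num) hB) (pow_nonneg (Real.log_natCast_nonneg m) _))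

end Summit.Parity.BatemanHorn.Theorems
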